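import Summits.QuantumFields.BalabanUV.T4Continuum.Support.NE9CurOfOneInstanceChart
import Summits.QuantumFields.BalabanUV.T4Continuum.Support.NE9CurveFromBackgroundMapEnd

/-!
# NE9CurOfOneInstanceChartEnd — THE END FED: NE9 leaf-06's END-M read-out face for curves of Bałaban's shape
# (`NE9CurveFromBackgroundMapEnd.termSize_ne9_and_fadingMemory_compCur_margProj_cpieceForm`, conclusion `TermSize ∧ NE9 ∧ FadingMemory` on the
# v1.3 dictionary) with its three background-map binders (Φ1)–(Φ3) DISCHARGED by the T23 «ONE INSTANCE» chart of `cur U` — `W80` in the W-slot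
# at the T-slot's own `(H(U), C(U), ε_C)`, the J-79 term IN the linear slot `Λ := −(𝔊(U) ∘L L_J)` — read per localization domain, and with the
# chart's positivity `hpos(U)` PRODUCED on the small-field set of a fixed lattice ([Balaban1985BackgroundPropagators] Thm 3.11, the owner's
# `B9Thm311SmallFieldClosed`); the pub-balaban NE9 desk's ARMED trigger T25 «THE NODE FED» read at the END face («the END ∕ a successor ∕
# `NE9CurveFromBackgroundMap` ∕ a summit-face consumer FED by the instance WITH the J-term», PRICING-NE9 v32 §H ∕ v34) together with T24; route
# R2′ of `t4/ROUTES-NE9.md`; cell `pub-balaban`, T4-DAG §2 node U3 ∕ §6 NE9; NE9 crux-team leaf lineage `b2b-balaban-t4-ne9-formalise-leaf-05`,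
# generation 67; Summits-side sequel of `NE9CurOfOneInstanceChart` under this seat's INTERFACE REQUEST NE9 (T24∕T25); nothing printed asserted

HONEST FRAMING (T4-DAG PAGE 1).  Rung (B)+1 of the FINITE-VOLUME T⁴ programme — NOT infinite volume, NOT a mass gap, NOT the Clay problem.  NE9
(`T4OutputRate.NE9` ∧ `FadingMemory`) is a cell NEW ESTIMATE, NOT PRINTED in [I] = [Balaban1987RG1] (CMP **109**), [II] = [Balaban1988RG2Cluster]
(CMP **116**), and NOT PROVED here: the conclusion below is «NE9 ⇐ the named binders» with THREE of them (the background-map TYPE facts) and ONE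
more (the chart's positivity, on the small-field set) PRODUCED — every other binder of the END face (the RAY species on the shift field, the
window family, `Factorises`, the activity tables `TwoPointKP`, `DecayExtract`, `PinBudget`, the read-out, the counts, the v1.3 arithmetic letters)
stays DISPLAYED VERBATIM; spine PROVED 0∕9.  HONEST DEPENDENCY (cell line, verbatim): continuum YM on T⁴ ⇐ BetaPertH ∧ nine spine estimates (0/9
proved); BetaPertH ⇐ (D1) ∧ (D4) ∧ CAP+tail; G-an2-4 gates asym, D1 and NE2/3/4.  The `cur U` OBJECT is ONE item of the MODEL O-NE9-1; that
Bałaban's 𝐇_k, U_j(□₀, exp iB), U^c_j meet the reading's two ball inclusions and the displayed binders is O-NE9-1 ∕ O-NE9-5, NOT claimed;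
NEEDS-COORDINATOR #5 UNRULED.

WHAT THIS FILE PROVES (0 def, 0 sorry, axioms standard).
* §1 **`termSize_ne9_and_fadingMemory_compCur_of_chart`** (generic): for ANY map `Φ₀ : ℬ → 𝒴` with (Ψ1)–(Ψ3) on `ball 0 R_b → ball 0 R′` and per-domain
  continuous linear readings `ιr X : E →L[ℂ] ℬ` (`ball 0 (Dd.R X) ↦ ball 0 R_b`), `πr X : 𝒴 →L[ℂ] E` (`ball 0 R′ ↦ ball 0 (R₁ X)`), any family `Φ`
  with `Φ X e = πr X (Φ₀ (ιr X e))` satisfies (Φ1)–(Φ3) (the owner's `NE9CurOfB11Chart.triple_read`), so END-COMP's conclusion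
  `TermSize Ef W κ N ∧ NE9 Ef W κ (prodModuli …) … ∧ FadingMemory …` holds with its other binders VERBATIM (bound names: its `W`, `κ`, `ρ`, `Ψ`,
  `a`, `d`, `α`, `R′`, `hpos`, `hL` are `Wd`, `κw`, `ρP`, `ΨF`, `aP`, `dP`, `αι`, `R₁`, `hdirB0`, `hLev` here) [folklore].
* §2 **`termSize_ne9_and_fadingMemory_compCur_of_oneInstance_smallField`** — AT THE CHAIN's LETTERS, T24 ∧ T25 at the END face: `∃ ε₃ > 0` such
  that for EVERY background `U` of E162's data with `‖U(b) − 1‖ ≤ ε ≤ ε₃` and `hRS`, all (L3) letters `ρ`, `τc`, V₀-slot `hqV`, `J`, `Δπ`: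
  `∃ hpos` (PRODUCED) and — at `H(U) := H1LatticeCLM φ hpos …`, `𝔊(U) := frakGLatticeCLM φ hpos …`, `C(U) := Cc …` — `‖𝔊(U) ∘L L_J‖ < 1 →
  ∃ a_C ε_C ε₄ R_b R′ > 0`, the Sect. C `Regime` ∧ for ALL readings with the two ball inclusions and every family `Φ` agreeing with
  `πr X ∘ chartHB 𝔊(U) (−(𝔊(U) ∘L L_J)) (W80 … ε_C J Δπ) 0 (A′ ↦ A′ + solA H(U) 0 C(U) 0 ε_C A′) ε₄ H(U) ∘ ιr X`, the five END binders that
  mention the curve datum (`LevelCountsG`, `Adm ⊆ analyticClass`, `Factorises`, `hρ`, `hbox` at `Dd.compCur Φ R₁`) imply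
  `TermSize ∧ NE9 ∧ FadingMemory` VERBATIM — the END-COMP binders that do not mention the curve datum are parameters, VERBATIM.
DISGUISE TEST: binder substitution by name ((A′)∕(B′) of this lineage + NE9 leaf-06's END-COMP); nothing of [I]–[II] ∕ [B9] ∕ [B11] asserted; no
inequality of the series proved; the Λ-road is ONE of T23's two admissible placements — the chain's road stays the OWNER's decision; not NE9.
References (TYPES ∕ loci only): [Balaban1985Variational] (47) p. 285, (84)–(90) pp. 290–291, (143) p. 300, (174)–(175) p. 305;
[Balaban1985BackgroundPropagators] Thm 3.11 p. 416; [Balaban1987RG1] (0.28)–(0.30) p. 258, (1.18) p. 263, (3.37) p. 277, Lemma 4 (3.53)–(3.54)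
p. 280; [Balaban1988RG2Cluster] (1.21)–(1.29) pp. 7–8, Lemma 3 (2.38) p. 20.  Imports `NE9CurOfOneInstanceChart` (this lineage gen 67) and
`NE9CurveFromBackgroundMapEnd` (NE9 leaf-06 gen 8) ONLY; modifies nothing; ROOT ∕ END files untouched.  Value = END-face bookkeeping (binder
substitution: (Φ1)–(Φ3) and `hpos` produced for the one-instance `cur U`), NOT summit progress.
-/

noncomputable section

namespace Summit.QuantumFields.BalabanUV.T4Continuum.NE9CurOfOneInstanceChartEnd

open scoped BigOperators InnerProductSpace
open Metric Set
open Literature.MathematicalPhysics.QuantumFieldTheory.Balaban1983to89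
open Literature.MathematicalPhysics.QuantumFieldTheory.Balaban1983to89.T4OutputRate
open Literature.MathematicalPhysics.QuantumFieldTheory.Balaban1983to89.T4HistoryLipschitzRecursion
open Literature.MathematicalPhysics.QuantumFieldTheory.Balaban1983to89.T4HistoryLipschitzOuter
open Literature.MathematicalPhysics.QuantumFieldTheory.Balaban1983to89.T4HistoryLipschitzActivity
open Literature.MathematicalPhysics.QuantumFieldTheory.Balaban1983to89.T4HistoryLipschitzActivity (ClusterGeom)
open Literature.MathematicalPhysics.QuantumFieldTheory.Balaban1983to89.T4HistoryLipschitzSegment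
open Summit.QuantumFields.BalabanUV.T4Continuum.NE9Lemma1Counting
open Summit.QuantumFields.BalabanUV.T4Continuum.NE9Lemma1Gain
open Summit.QuantumFields.BalabanUV.T4Continuum.NE9Lemma1PieceClass
open Summit.QuantumFields.BalabanUV.T4Continuum.NE9Lemma1RemainderSpecies
open Summit.QuantumFields.BalabanUV.T4Continuum.NE9Lemma1CurveSpecies
open Summit.QuantumFields.BalabanUV.T4Continuum.NE9ComplexEncoding (doubleCarriers)
open Summit.QuantumFields.BalabanUV.T4Continuum.NE9LastCouplingBridge
open Summit.QuantumFields.BalabanUV.T4Continuum.NE9BridgeSizeInduction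
open Summit.QuantumFields.BalabanUV.T4Continuum.NE9MarginalProjection
open Summit.QuantumFields.BalabanUV.T4Continuum.NE9MarginalProjectionEnd
open Summit.QuantumFields.BalabanUV.T4Continuum.NE9CurveFromBackgroundMap
open Summit.QuantumFields.BalabanUV.T4Continuum.NE9CurveFromBackgroundMapEnd (termSize_ne9_and_fadingMemory_compCur_margProj_cpieceForm)
open Summit.QuantumFields.BalabanUV.T4Continuum.NE9CurOfB11Chart (triple_read)
open B11Eq103H1Complex B11Eq115Space B11Eq174Chart
open B11Eq111FrakG (nabla115)
open B9Eq319QprimeTorus (fineP)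
open B9SectCLatticeCarrier (Bond)
open B4Sect5Torus (TSite)
open B7Prop1Explicit (U1 Wcx boxVec)
open B9Eq315QTorus (perCfg cornerSite QtorusW laplaceAofBackground)
open B9Eq315QTorusOnto (QtorusW_surjective)
open B9Eq310HessianOperator (adTransportW)
open B11Eq44COperatorTorus (Cc)
open B11Eq63V0GroupCurrent (curV0)
open B11Eq80Current (W80)
open B11Eq79LinearTerm (LJ)
open Summit.QuantumFields.BalabanUV.T4Continuum.NE9CurChartOneInstanceSmallField (cur_chart_exists_oneInstance_smallField)

variable {C₀ : Carriers} {E : Type} [NormedAddCommGroup E] [NormedSpace ℂ E] {ι' αι β γ δ : Type} [DecidableEq δ]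

variable (G : ClusterGeom (doubleCarriers C₀)) {Pot : Type*} [NormedAddCommGroup Pot] [NormedSpace ℂ Pot]

/-! ## §1 Generic: ANY chart with (Ψ1)–(Ψ3), read per domain, feeds the END-M read-out face -/

/-- **NE9 ∧ FADING MEMORY ∧ TERM SIZE FOR CURVES OF BAŁABAN'S SHAPE THROUGH ANY CHART WITH (Ψ1)–(Ψ3), READ PER DOMAIN** (kernel; binder
substitution).  If `Φ₀ : ℬ → 𝒴` is `DifferentiableOn ℂ` on `ball 0 R_b`, maps it into `ball 0 R′` and fixes `0`, and `ιr X : E →L[ℂ] ℬ`,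
`πr X : 𝒴 →L[ℂ] E` read it per localization domain with `ιr X (ball 0 (Dd.R X)) ⊆ ball 0 R_b`, `πr X (ball 0 R′) ⊆ ball 0 (R₁ X)`, then every
background-map family `Φ` with `Φ X e = πr X (Φ₀ (ιr X e))` has (Φ1)–(Φ3) (`NE9CurOfB11Chart.triple_read`), so NE9 leaf-06's END-COMP
`termSize_ne9_and_fadingMemory_compCur_margProj_cpieceForm` applies: its conclusion VERBATIM, its binders other than `hΦan ∕ hΦmaps ∕ hΦ0`
VERBATIM (bound-name changes only, see the module docstring). [folklore] -/
theorem termSize_ne9_and_fadingMemory_compCur_of_chart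
    {ℬ 𝒴 : Type*} [NormedAddCommGroup ℬ] [NormedSpace ℂ ℬ] [NormedAddCommGroup 𝒴] [NormedSpace ℂ 𝒴]
    {Φ₀ : ℬ → 𝒴} {Rb R' : ℝ} (hΦ1 : DifferentiableOn ℂ Φ₀ (ball 0 Rb)) (hΦ2 : MapsTo Φ₀ (ball 0 Rb) (ball 0 R')) (hΦ3 : Φ₀ 0 = 0)
    {Dd : RemData C₀ E ι' αι β γ δ} {R₁ : C₀.Dom → ℝ} (ιr : C₀.Dom → (E →L[ℂ] ℬ)) (πr : C₀.Dom → (𝒴 →L[ℂ] E))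
    (hιr : ∀ X, MapsTo (ιr X) (ball 0 (Dd.R X)) (ball 0 Rb)) (hπr : ∀ X, MapsTo (πr X) (ball 0 R') (ball 0 (R₁ X)))
    {Φ : C₀.Dom → E → E} (hΦ : ∀ X e, Φ X e = πr X (Φ₀ (ιr X e)))
    -- END-COMP's binders, verbatim (bound names as in the module docstring)
    {ℓg : ℕ → ℕ → ℝ} {cdir d0 : ℝ}
    {Ef : Functional (doubleCarriers C₀) E} {Wd : Set (ℕ → ℝ)} {Adm S : Set (E → (doubleCarriers C₀).Dom → ℝ)}
    {r : ℕ → (E → (doubleCarriers C₀).Dom → ℝ) → ℝ} {A : E → (doubleCarriers C₀).Dom → ℝ}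
    {ΨF : ℕ → ℝ → (ι' → ℝ) → E → (doubleCarriers C₀).Dom → ℝ} {act : ℕ → ℝ → E → Pot → G.P → ℂ} {𝒜 : ℕ → Set Pot}
    {n : ℕ → ℝ → E → G.P → ℝ} {lip clip : ℕ → ℝ} {aP dP : G.P → ℝ} {δv : (doubleCarriers C₀).Dom → ℝ}
    {κw O1 cQ ω clipd Nbar B lipbar clipbar cr aA : ℝ} {p₀ N : ℕ → ℝ}
    (ρP : ℕ → (ι' → ℝ) → Pot) (U₀ : E) (explZ : ℕ → E → (doubleCarriers C₀).Dom → ℝ) (h0 : ScaleZeroFree Ef Wd)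
    (hAdm : AdmissibleTerms Ef Wd Adm) (hres : AdmRestrict Adm)
    (hDd : Dd.Admissible ℓg cdir d0) (hdirB0 : ∀ k s y a' b x, 0 < Dd.dirB k s y a' b x)
    (hdirC : ∀ k s y a' b x, Continuous fun p : ℂ × (δ → ℝ) × (δ → ℂ) => Dd.dir k s y a' b x p.1 p.2.1 p.2.2)
    (hdirB : ∀ k s y a' b x t s' σ', ‖Dd.dir k s y a' b x t s' σ'‖ ≤ Dd.dirB k s y a' b x)
    (hLev : LevelCountsG (Dd.compCur Φ R₁).toC.frame κw (Dd.compCur Φ R₁).κ₁ O1 cQ (fun k j => ℓg k j ^ 5) (agePow ω))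
    (hAdmAn : Adm ⊆ analyticClass (Dd.compCur Φ R₁).R)
    (hrA : ReadAdditive Adm r) (hr0 : ReadZero r) (hrs : ReadSize Adm r κw cr) (hA : DirSize A κw aA) (hcr : 0 ≤ cr)
    (haA : 0 ≤ aA)
    (hAan : A ∈ analyticClass (Dd.compCur Φ R₁).R)
    (hAmul : ∀ c : ℕ → ℝ, (fun U X' => c ((doubleCarriers C₀).scale X') * A U X') ∈ Adm)
    (hcoef : ∀ (j : ℕ) (c : ℝ), r j (restrictScale j (c • A)) = c * r j (restrictScale j A))
    (hnorm : ∀ j : ℕ, r j (restrictScale j A) = 1 ∨ ∀ H ∈ Adm, r j (restrictScale j H) = 0)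
    (hS : ∀ H ∈ Adm, margProj r A H ∈ S)
    (hclipd : 0 ≤ clipd) (hcdir : 0 < cdir) (hℓpos : ∀ k j, 0 < ℓg k j) (hhalf : ∀ k j, cdir * ℓg k j < 1 / 2)
    (hcont : ∀ (k : ℕ) (s : ℕ → ℝ) (y : ι') (a' : αι) (b : β) (x : (doubleCarriers C₀).Dom),
      ContinuousOn (fun p : ℂ × ((δ → ℝ) × (δ → ℂ)) => Dd.dir k s y a' b x p.1 p.2.1 p.2.2)
        (sphere (0:ℂ) (Dd.r k) ×ˢ {q | OnContour Dd.κ₁ (Dd.cubes k y a' b) q.1 q.2}))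
    (hlip : ∀ g ∈ Wd, ∀ g' ∈ Wd, ∀ (k : ℕ) (y : ι'), ∀ a' ∈ Dd.S0 k y, ∀ b ∈ Dd.SY k y a', ∀ (j : ℕ), ∀ x ∈ Dd.src k y a' j,
      ∀ t ∈ sphere (0:ℂ) (Dd.r k), ∀ (s' : δ → ℝ) (σ' : δ → ℂ), OnContour Dd.κ₁ (Dd.cubes k y a' b) s' σ' →
        ‖Dd.dir k g y a' b x t s' σ' - Dd.dir k g' y a' b x t s' σ'‖ ≤ clipd * (cdir * ℓg k j * Dd.R x.1) * |g k - g' k|)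
    (hO1 : 0 ≤ O1) (hcQ : 0 ≤ cQ) (hω0 : 0 ≤ ω) (hω1 : ω < 1) (hNb : ∀ j, N j ≤ Nbar)
    (hfac : Factorises Ef Wd (compProj (cpieceChannel (Dd.compCur Φ R₁).toC) (margProj r A)) ΨF) (hclip0 : ∀ k, 0 ≤ clip k)
    (hCup : ∀ g ∈ Wd, ∀ g' ∈ Wd, ∀ (k : ℕ) (Ue : E) (X : (doubleCarriers C₀).Dom), (doubleCarriers C₀).scale X = k + 1 →
      ∀ Q ∈ 𝒜 k, ∀ γ' ∈ G.vol X,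
      ‖act k (g k) Ue Q γ'‖ ≤ n k (g' k) Ue γ' ∧
        ‖act k (g k) Ue Q γ' - act k (g' k) Ue Q γ'‖ ≤ clip k * |g k - g' k| * n k (g' k) Ue γ')
    (hreprV : ∀ (k : ℕ) (s : ℝ) (Q : ι' → ℝ) (Ue : E) (X : (doubleCarriers C₀).Dom),
      ΨF k s Q Ue X = (G.newTerm act k s Ue X (ρP k Q)).re - (G.newTerm act k s U₀ X (ρP k Q)).re + explZ k Ue X)
    (hclipb : ∀ k, clip k ≤ clipbar)
    (hK : TwoPointKP G Wd act 𝒜 n lip aP dP) (hdec : G.DecayExtract δv dP) (hpin : G.PinBudget aP δv (fun _ => B) κw)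
    (hρ : ∀ (k : ℕ) (Q Q' : ι' → ℝ) (M : ℝ),
      (∀ y, |Q y - Q' y| ≤ weightOf (Dd.compCur Φ R₁).toC.frame (Dd.compCur Φ R₁).κ₁ d0 O1 ((Dd.compCur Φ R₁).Kp cdir) k y
        * M) → ‖ρP k Q - ρP k Q'‖ ≤ M)
    (hexplZ : ∀ (k : ℕ) (Ue : E) (X : (doubleCarriers C₀).Dom), (doubleCarriers C₀).scale X = k + 1 →
      |explZ k Ue X| ≤ Real.exp (-(κw * (doubleCarriers C₀).d X)) * p₀ k)
    (hbase : ∀ g ∈ Wd, ∀ (Ue : E) (X : (doubleCarriers C₀).Dom), (doubleCarriers C₀).scale X = 0 →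
      |Ef g Ue X| ≤ Real.exp (-(κw * (doubleCarriers C₀).d X)) * N 0)
    (hNsucc : ∀ j, p₀ j + 2 * B ≤ N (j + 1)) (hNnn : ∀ j, 0 ≤ N j)
    (hbox : ∀ (k : ℕ) (Q : ι' → ℝ),
      (∀ y, |Q y| ≤ weightOf (Dd.compCur Φ R₁).toC.frame (Dd.compCur Φ R₁).κ₁ d0 O1 ((Dd.compCur Φ R₁).Kp cdir) k y *
        sizeRadius (fun k j => (1 + cr * aA) * tauOfG cQ (agePow ω) k j) N k) → ρP k Q ∈ 𝒜 k)
    (hB : 0 ≤ B) (hlipb : ∀ k, lip k ≤ lipbar) (hpos' : 0 < ω + 8 * lipbar * B * ((1 + cr * aA) * cQ)) :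
    TermSize Ef Wd κw N ∧
      NE9 Ef Wd κw (prodModuli (8 * clipbar * B + 8 * lipbar * B *
          ((64 * (4 * clipd) * Nbar + cr * Nbar * (64 * (4 * clipd) * aA)) * cQ * (1 - ω)⁻¹))
        fun _ => ω + 8 * lipbar * B * ((1 + cr * aA) * cQ)) ∧
        FadingMemory ((8 * clipbar * B + 8 * lipbar * B *
              ((64 * (4 * clipd) * Nbar + cr * Nbar * (64 * (4 * clipd) * aA)) * cQ * (1 - ω)⁻¹)) /
            (ω + 8 * lipbar * B * ((1 + cr * aA) * cQ)))
          (ω + 8 * lipbar * B * ((1 + cr * aA) * cQ))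
          (prodModuli (8 * clipbar * B + 8 * lipbar * B *
              ((64 * (4 * clipd) * Nbar + cr * Nbar * (64 * (4 * clipd) * aA)) * cQ * (1 - ω)⁻¹))
            fun _ => ω + 8 * lipbar * B * ((1 + cr * aA) * cQ)) := by
  have hΦeq : Φ = fun X e => πr X (Φ₀ (ιr X e)) := funext fun X => funext (hΦ X)
  have htr : ∀ X, DifferentiableOn ℂ (Φ X) (ball 0 (Dd.R X)) ∧ MapsTo (Φ X) (ball 0 (Dd.R X)) (ball 0 (R₁ X)) ∧ Φ X 0 = 0 := by
    intro X
    rw [hΦeq]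
    exact triple_read hΦ1 hΦ2 hΦ3 (ιr X) (πr X) (hιr X) (hπr X)
  exact termSize_ne9_and_fadingMemory_compCur_margProj_cpieceForm G ρP U₀ explZ h0 hAdm hres hDd hdirB0 hdirC hdirB
    (fun X => (htr X).1) (fun X => (htr X).2.1) (fun X => (htr X).2.2) hLev hAdmAn hrA hr0 hrs hA hcr haA hAan hAmul hcoef hnorm hS
    hclipd hcdir hℓpos hhalf hcont hlip hO1 hcQ hω0 hω1 hNb hfac hclip0 hCup hreprV hclipb hK hdec hpin hρ hexplZ hbase hNsucc hNnn hbox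
    hB hlipb hpos'

/-! ## §2 AT THE CHAIN's LETTERS: the END fed by the one-instance chart WITH the J-term, `hpos(U)` PRODUCED on the small-field set -/

set_option maxRecDepth 8192 in
/-- **NE9 ∧ FADING MEMORY ∧ TERM SIZE, THE BACKGROUND MAP BEING THE ONE-INSTANCE CHART OF `cur U` WITH THE J-TERM, AT EVERY SMALL FIELD OF A FIXED
LATTICE** (desk T24 ∧ T25 at the END face; binder substitution).  There is `ε₃ > 0` (a finite-lattice number; the owner's
`B9Thm311SmallFieldClosed.laplaceAofBackground_pos_of_small_field`, [Balaban1985BackgroundPropagators] Thm 3.11) such that for EVERY background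
`U` of E162's data with `‖U(b) − 1‖ ≤ ε ≤ ε₃` and mutually adjoint transporters `hRS`, all (L3) letters `ρ`, `τc`, V₀-slot `hqV`, `J`, `Δπ`:
`∃ hpos` (PRODUCED) and — at `H(U) := H1LatticeCLM φ hpos …`, `𝔊(U) := frakGLatticeCLM φ hpos …`, `C(U) := Cc …` — whenever `‖𝔊(U) ∘L L_J‖ < 1`
there are `a_C ε_C ε₄ R_b R′ > 0` with the Sect. C `Regime` of (47) at `(H(U), C(U), a_C, ε_C)` such that for ALL per-domain readings `ιr`, `πr`
with the two ball inclusions and every background-map family `Φ` with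
`Φ X e = πr X (chartHB 𝔊(U) (−(𝔊(U) ∘L L_J)) (W80 ρ τc U H(U) C(U) ε_C J Δπ) 0 (A′ ↦ A′ + solA H(U) 0 C(U) 0 ε_C A′) ε₄ H(U) (ιr X e))`, the five
END-COMP binders that mention the curve datum `Dd.compCur Φ R₁` (`LevelCountsG`, `Adm ⊆ analyticClass`, `A ∈ analyticClass`, `Factorises`,
`hρ`, `hbox`) imply END-COMP's conclusion `TermSize ∧ NE9 ∧ FadingMemory` VERBATIM; the END-COMP binders not mentioning the curve datum are
parameters VERBATIM.  Displayed on the chart side: E162's data, `ε ≤ ε₃`, `hRS`, the fibre∕trace letters, `0 < a`, the V₀-slot, `‖𝔊(U) ∘L L_J‖ < 1`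
— NO positivity binder and NO background-map TYPE fact. [folklore] -/
theorem termSize_ne9_and_fadingMemory_compCur_of_oneInstance_smallField {d : ℕ} (L : ℕ) [NeZero L] (m : Fin d → ℕ)
    [∀ i, NeZero (fineP L m i)] (hL : 1 ≤ L)
    {𝔸 : Type*} [NormedRing 𝔸] [NormedAlgebra ℂ 𝔸] [CompleteSpace 𝔸] [NormOneClass 𝔸] [StarRing 𝔸] [NormedStarGroup 𝔸] [StarModule ℂ 𝔸]
    [FiniteDimensional ℂ 𝔸]
    {W : Type*} [NormedAddCommGroup W] [InnerProductSpace ℂ W] [FiniteDimensional ℂ W] (φ : W ≃ₗ[ℂ] 𝔸) {Mφ Mφ' : ℝ} (hMφ : 0 ≤ Mφ)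
    (hMφ' : 0 ≤ Mφ') (hφ : ∀ w, ‖φ w‖ ≤ Mφ * ‖w‖) (hφ' : ∀ X, ‖φ.symm X‖ ≤ Mφ' * ‖X‖)
    (τ : 𝔸 →ₗ[ℂ] ℂ) {Cτ : ℝ} (hτ : ∀ X, ‖τ X‖ ≤ Cτ * ‖X‖) (hCτ : 0 ≤ Cτ)
    {η : ℝ} [Fact (0 < (L : ℝ))] [Fact (0 < η)] {lev₀ : Bond d (fineP L m) → ℕ} {levB : Bond d m → ℕ} (lev₁ : Bond d (fineP L m) × Fin d → ℕ)
    (hlev : ∀ b, 1 ≤ lev₀ b) {c₀ c₁ : ℝ} [Fact (0 < c₀)] [Fact (0 < c₁)] {a : ℝ} (ha : 0 < a)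
    -- END-COMP's binders NOT mentioning the curve datum, verbatim (bound names as in the module docstring)
    {Dd : RemData C₀ E ι' αι β γ δ} {R₁ : C₀.Dom → ℝ} {ℓg : ℕ → ℕ → ℝ} {cdir d0 : ℝ}
    {Ef : Functional (doubleCarriers C₀) E} {Wd : Set (ℕ → ℝ)} {Adm S : Set (E → (doubleCarriers C₀).Dom → ℝ)}
    {r : ℕ → (E → (doubleCarriers C₀).Dom → ℝ) → ℝ} {A : E → (doubleCarriers C₀).Dom → ℝ}
    {ΨF : ℕ → ℝ → (ι' → ℝ) → E → (doubleCarriers C₀).Dom → ℝ} {act : ℕ → ℝ → E → Pot → G.P → ℂ} {𝒜 : ℕ → Set Pot}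
    {n : ℕ → ℝ → E → G.P → ℝ} {lip clip : ℕ → ℝ} {aP dP : G.P → ℝ} {δv : (doubleCarriers C₀).Dom → ℝ}
    {κw O1 cQ ω clipd Nbar B lipbar clipbar cr aA : ℝ} {p₀ N : ℕ → ℝ}
    (ρP : ℕ → (ι' → ℝ) → Pot) (U₀ : E) (explZ : ℕ → E → (doubleCarriers C₀).Dom → ℝ) (h0 : ScaleZeroFree Ef Wd)
    (hAdm : AdmissibleTerms Ef Wd Adm) (hres : AdmRestrict Adm)
    (hDd : Dd.Admissible ℓg cdir d0) (hdirB0 : ∀ k s y a' b x, 0 < Dd.dirB k s y a' b x)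
    (hdirC : ∀ k s y a' b x, Continuous fun p : ℂ × (δ → ℝ) × (δ → ℂ) => Dd.dir k s y a' b x p.1 p.2.1 p.2.2)
    (hdirB : ∀ k s y a' b x t s' σ', ‖Dd.dir k s y a' b x t s' σ'‖ ≤ Dd.dirB k s y a' b x)
    (hrA : ReadAdditive Adm r) (hr0 : ReadZero r) (hrs : ReadSize Adm r κw cr) (hA : DirSize A κw aA) (hcr : 0 ≤ cr)
    (haA : 0 ≤ aA)
    (hAmul : ∀ c : ℕ → ℝ, (fun U X' => c ((doubleCarriers C₀).scale X') * A U X') ∈ Adm)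
    (hcoef : ∀ (j : ℕ) (c : ℝ), r j (restrictScale j (c • A)) = c * r j (restrictScale j A))
    (hnorm : ∀ j : ℕ, r j (restrictScale j A) = 1 ∨ ∀ H ∈ Adm, r j (restrictScale j H) = 0)
    (hS : ∀ H ∈ Adm, margProj r A H ∈ S)
    (hclipd : 0 ≤ clipd) (hcdir : 0 < cdir) (hℓpos : ∀ k j, 0 < ℓg k j) (hhalf : ∀ k j, cdir * ℓg k j < 1 / 2)
    (hcont : ∀ (k : ℕ) (s : ℕ → ℝ) (y : ι') (a' : αι) (b : β) (x : (doubleCarriers C₀).Dom),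
      ContinuousOn (fun p : ℂ × ((δ → ℝ) × (δ → ℂ)) => Dd.dir k s y a' b x p.1 p.2.1 p.2.2)
        (sphere (0:ℂ) (Dd.r k) ×ˢ {q | OnContour Dd.κ₁ (Dd.cubes k y a' b) q.1 q.2}))
    (hlip : ∀ g ∈ Wd, ∀ g' ∈ Wd, ∀ (k : ℕ) (y : ι'), ∀ a' ∈ Dd.S0 k y, ∀ b ∈ Dd.SY k y a', ∀ (j : ℕ), ∀ x ∈ Dd.src k y a' j,
      ∀ t ∈ sphere (0:ℂ) (Dd.r k), ∀ (s' : δ → ℝ) (σ' : δ → ℂ), OnContour Dd.κ₁ (Dd.cubes k y a' b) s' σ' →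
        ‖Dd.dir k g y a' b x t s' σ' - Dd.dir k g' y a' b x t s' σ'‖ ≤ clipd * (cdir * ℓg k j * Dd.R x.1) * |g k - g' k|)
    (hO1 : 0 ≤ O1) (hcQ : 0 ≤ cQ) (hω0 : 0 ≤ ω) (hω1 : ω < 1) (hNb : ∀ j, N j ≤ Nbar) (hclip0 : ∀ k, 0 ≤ clip k)
    (hCup : ∀ g ∈ Wd, ∀ g' ∈ Wd, ∀ (k : ℕ) (Ue : E) (X : (doubleCarriers C₀).Dom), (doubleCarriers C₀).scale X = k + 1 →
      ∀ Q ∈ 𝒜 k, ∀ γ' ∈ G.vol X,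
      ‖act k (g k) Ue Q γ'‖ ≤ n k (g' k) Ue γ' ∧
        ‖act k (g k) Ue Q γ' - act k (g' k) Ue Q γ'‖ ≤ clip k * |g k - g' k| * n k (g' k) Ue γ')
    (hreprV : ∀ (k : ℕ) (s : ℝ) (Q : ι' → ℝ) (Ue : E) (X : (doubleCarriers C₀).Dom),
      ΨF k s Q Ue X = (G.newTerm act k s Ue X (ρP k Q)).re - (G.newTerm act k s U₀ X (ρP k Q)).re + explZ k Ue X)
    (hclipb : ∀ k, clip k ≤ clipbar)
    (hK : TwoPointKP G Wd act 𝒜 n lip aP dP) (hdec : G.DecayExtract δv dP) (hpin : G.PinBudget aP δv (fun _ => B) κw)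
    (hexplZ : ∀ (k : ℕ) (Ue : E) (X : (doubleCarriers C₀).Dom), (doubleCarriers C₀).scale X = k + 1 →
      |explZ k Ue X| ≤ Real.exp (-(κw * (doubleCarriers C₀).d X)) * p₀ k)
    (hbase : ∀ g ∈ Wd, ∀ (Ue : E) (X : (doubleCarriers C₀).Dom), (doubleCarriers C₀).scale X = 0 →
      |Ef g Ue X| ≤ Real.exp (-(κw * (doubleCarriers C₀).d X)) * N 0)
    (hNsucc : ∀ j, p₀ j + 2 * B ≤ N (j + 1)) (hNnn : ∀ j, 0 ≤ N j)
    (hB : 0 ≤ B) (hlipb : ∀ k, lip k ≤ lipbar) (hpos' : 0 < ω + 8 * lipbar * B * ((1 + cr * aA) * cQ)) :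
    ∃ ε₃ : ℝ, 0 < ε₃ ∧ ∀ (U : Bond d (fineP L m) → 𝔸ˣ) {α : ℝ} (hα : α ≤ 1 / 128) (hα1 : α ≤ 1 / 64)
      (hU1 : ∀ (x : B7Prop1Explicit.Site d) (κ : Fin d), perCfg (fineP L m) U x κ ∈ U1 𝔸)
      (hreg : ∀ (y : TSite d m) (κ : Fin d) (r : Fin d → Fin L),
        ‖((Wcx L (perCfg (fineP L m) U) (cornerSite L y) κ (boxVec L r) : 𝔸ˣ) : 𝔸) - 1‖ ≤ α)
      (hαL : 50 * (d + 1) * α * (L : ℝ) ^ d ≤ 1 / 2) {ε : ℝ}, 0 ≤ ε → ε ≤ ε₃ → (∀ b, ‖(U b : 𝔸) - 1‖ ≤ ε) →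
      (∀ (b : Bond d (fineP L m)) (v u : W), inner ℂ (adTransportW φ U b v) u = inner ℂ v (adTransportW φ (fun b => (U b)⁻¹) b u)) →
      ∀ (ρ : (𝔸 →L[ℂ] ℂ) →L[ℂ] 𝔸) (τc : 𝔸 →L[ℂ] ℂ) {CV RV : ℝ}, 0 ≤ CV → 0 < RV →
        (∀ Y : Space115 (L : ℝ) η lev₀ lev₁ (nabla115 η U), ‖Y‖ < RV →
          ‖curV0 (lev₁ := lev₁) (Dc := nabla115 η U) ρ τc U Y‖ ≤ CV * ‖Y‖ ^ 2) →
      ∀ (J : NegSize (L : ℝ) η lev₀ 3 𝔸) (Δπ : Space115 (L : ℝ) η lev₀ lev₁ (nabla115 η U) →L[ℂ] NegSize (L : ℝ) η lev₀ 3 𝔸),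
      ∃ hpos : ∀ x : BondL2K ℂ d (fineP L m) c₀ W, x ≠ 0 →
          0 < RCLike.re (inner ℂ x (laplaceAofBackground L m hL φ U hα1 hU1 hreg τ η (c₀ := c₀) (c₁ := c₁) a x)),
      let Hc := H1LatticeCLM (lev₀ := lev₀) (levB := levB) φ hpos (QtorusW_surjective L m hL U hα1 hU1 hreg hαL φ) lev₁ (nabla115 η U)
      let Gc := frakGLatticeCLM (lev₀ := lev₀) φ hpos (QtorusW_surjective L m hL U hα1 hU1 hreg hαL φ) lev₁ (nabla115 η U)
      let Cx := Cc L m η U lev₀ lev₁ (nabla115 η U) levB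
      ‖Gc.comp (LJ ρ τc Hc Cx J)‖ < 1 →
      ∃ aC εC ε₄ Rb R' : ℝ, 0 < aC ∧ 0 < εC ∧ 0 < ε₄ ∧ 0 < Rb ∧ 0 < R' ∧
        Regime Hc 0 Cx ‖Hc‖ 0 (2097152 * ((d : ℝ) + 1) ^ 2) (1 / (512 * ((d : ℝ) + 1))) 0 aC εC ∧
        ∀ (ιr : C₀.Dom → (E →L[ℂ] NegSize (L : ℝ) η levB 0 𝔸)) (πr : C₀.Dom → (Space115 (L : ℝ) η lev₀ lev₁ (nabla115 η U) →L[ℂ] E)),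
          (∀ X, MapsTo (ιr X) (ball 0 (Dd.R X)) (ball 0 Rb)) → (∀ X, MapsTo (πr X) (ball 0 R') (ball 0 (R₁ X))) →
          ∀ (Φ : C₀.Dom → E → E), (∀ X e, Φ X e = πr X (chartHB Gc (-(Gc.comp (LJ ρ τc Hc Cx J))) (W80 ρ τc U Hc Cx εC J Δπ) 0
              (fun A' => A' + solA Hc 0 Cx 0 εC A') ε₄ Hc (ιr X e))) →
          -- END-COMP's binders that mention the curve datum `Dd.compCur Φ R₁`
          LevelCountsG (Dd.compCur Φ R₁).toC.frame κw (Dd.compCur Φ R₁).κ₁ O1 cQ (fun k j => ℓg k j ^ 5) (agePow ω) →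
          Adm ⊆ analyticClass (Dd.compCur Φ R₁).R → A ∈ analyticClass (Dd.compCur Φ R₁).R →
          Factorises Ef Wd (compProj (cpieceChannel (Dd.compCur Φ R₁).toC) (margProj r A)) ΨF →
          (∀ (k : ℕ) (Q Q' : ι' → ℝ) (M : ℝ),
            (∀ y, |Q y - Q' y| ≤ weightOf (Dd.compCur Φ R₁).toC.frame (Dd.compCur Φ R₁).κ₁ d0 O1 ((Dd.compCur Φ R₁).Kp cdir) k y
              * M) → ‖ρP k Q - ρP k Q'‖ ≤ M) →
          (∀ (k : ℕ) (Q : ι' → ℝ),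
            (∀ y, |Q y| ≤ weightOf (Dd.compCur Φ R₁).toC.frame (Dd.compCur Φ R₁).κ₁ d0 O1 ((Dd.compCur Φ R₁).Kp cdir) k y *
              sizeRadius (fun k j => (1 + cr * aA) * tauOfG cQ (agePow ω) k j) N k) → ρP k Q ∈ 𝒜 k) →
          TermSize Ef Wd κw N ∧
            NE9 Ef Wd κw (prodModuli (8 * clipbar * B + 8 * lipbar * B *
                ((64 * (4 * clipd) * Nbar + cr * Nbar * (64 * (4 * clipd) * aA)) * cQ * (1 - ω)⁻¹))
              fun _ => ω + 8 * lipbar * B * ((1 + cr * aA) * cQ)) ∧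
              FadingMemory ((8 * clipbar * B + 8 * lipbar * B *
                    ((64 * (4 * clipd) * Nbar + cr * Nbar * (64 * (4 * clipd) * aA)) * cQ * (1 - ω)⁻¹)) /
                  (ω + 8 * lipbar * B * ((1 + cr * aA) * cQ)))
                (ω + 8 * lipbar * B * ((1 + cr * aA) * cQ))
                (prodModuli (8 * clipbar * B + 8 * lipbar * B *
                    ((64 * (4 * clipd) * Nbar + cr * Nbar * (64 * (4 * clipd) * aA)) * cQ * (1 - ω)⁻¹))
                  fun _ => ω + 8 * lipbar * B * ((1 + cr * aA) * cQ)) := by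
  obtain ⟨ε₃, hε₃, H⟩ := cur_chart_exists_oneInstance_smallField L m hL φ hMφ hMφ' hφ hφ' τ hτ hCτ (η := η) (lev₀ := lev₀)
    (levB := levB) lev₁ hlev (c₀ := c₀) (c₁ := c₁) ha
  refine ⟨ε₃, hε₃, fun U α hα hα1 hU1 hreg hαL ε hε hεε₃ hUε hRS ρ τc CV RV hCV hRV hqV J Δπ => ?_⟩
  obtain ⟨hpos, hchart⟩ := H U hα hα1 hU1 hreg hαL hε hεε₃ hUε hRS ρ τc hCV hRV hqV J Δπ
  refine ⟨hpos, ?_⟩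
  intro Hc Gc Cx hθ
  obtain ⟨aC, εC, ε₄, Rb, R', haC, hεC, hε₄, hRb, hR', RC, hΦ1, hΦ2, hΦ3⟩ := hchart hθ
  refine ⟨aC, εC, ε₄, Rb, R', haC, hεC, hε₄, hRb, hR', RC, ?_⟩
  intro ιr πr hιr hπr Φ hΦ hLev hAdmAn hAan hfac hρ hbox
  exact termSize_ne9_and_fadingMemory_compCur_of_chart G hΦ1 hΦ2 hΦ3 ιr πr hιr hπr hΦ ρP U₀ explZ h0 hAdm hres hDd hdirB0 hdirC
    hdirB hLev hAdmAn hrA hr0 hrs hA hcr haA hAan hAmul hcoef hnorm hS hclipd hcdir hℓpos hhalf hcont hlip hO1 hcQ hω0 hω1 hNb hfac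
    hclip0 hCup hreprV hclipb hK hdec hpin hρ hexplZ hbase hNsucc hNnn hbox hB hlipb hpos'

end Summit.QuantumFields.BalabanUV.T4Continuum.NE9CurOfOneInstanceChartEnd

end
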